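import Literature.AlgebraicGeometry.HodgeTheory.FermatJoinColonIdeal
import Literature.AlgebraicGeometry.DuqueFrancoVillaflor2025.JoinHilbertFunctionIdeal
import Literature.AlgebraicGeometry.HodgeTheory.FermatLinearCycleGorensteinIdeal
import HarnessLib

/-!
# Hilbert functions of joins and cones in the Fermat variety (Duque Franco–Villaflor 2025, Cor. 6.1, Ex. 6.1, Rem. 7.2)

J. Duque Franco, R. Villaflor Loyola, *Periods of join algebraic cycles*, Ann. Sc. Norm. Super. Pisa Cl. Sci.
(2025) = arXiv:2312.17222 [DuqueFrancoVillaflor2025Join] (text read: arXiv version, pp. 17–18):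

> **Corollary 6.1.** In the same context of (Thm. 1.1) we have `HF_{[J(Z₁,Z₂)]} = HF_{[Z₁]} * HF_{[Z₂]}`, this
> means that for all `k ≥ 0`, `HF_{[J(Z₁,Z₂)]}(k) = Σ_{p+q=k} HF_{[Z₁]}(p)·HF_{[Z₂]}(q)`.
>
> **Example 6.1.** […] `HF_{[ℙ^{n/2}]} = φ^{*(n/2+1)}` where `φ : ℤ_{≥0} → ℤ_{≥0}` is the Hilbert function of a
> point in a `0`-dimensional Fermat variety, `φ(k) = 1` if `0 ≤ k ≤ d−2`, `0` otherwise.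
>
> **Remark 7.2.** […] More generally, for any algebraic cycle given as a cone `Z = J(pt, Z₂)` we can construct a
> fake version of `Z` if we replace the point by a `0`-dimensional fake linear cycle.

**What this file proves**, at the Fermat point and unconditionally (any field `K`, `e = d − 1 ≥ 1`,
`J_ι = (x_i^e : i ∈ ι)`; companion of `FermatJoinColonIdeal.lean` = Thm. 1.1 at the Fermat point and of
`DuqueFrancoVillaflor2025/JoinHilbertFunctionIdeal.lean` = Cor. 6.1 in ideal form):
* **`hilbert_span_X_pow_colon_rename_mul`** (Cor. 6.1): for forms `P ∉ J_σ`, `Q ∉ J_τ` the Hilbert function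
  of `S/(J_{σ⊔τ} : P(x)Q(y))` is the convolution of those of `K[x]/(J_σ : P)` and `K[y]/(J_τ : Q)`;
* **`hilbert_span_X_pow_colon_fermatPoint`** (Ex. 6.1): for `pt` a point of `{x₀^d + x₁^d = 0}` (more
  generally any `c`: `P_pt = (x₀^e − (c x₁)^e)/(x₀ − c x₁)`, tree `fermatLinearCyclePolynomial` with one pair of
  variables; `(J : P_pt) = ⟨x₀ − c x₁, x₀^e, x₁^e⟩`) the Hilbert function of `K[x₀,x₁]/(J : P_pt)` is `φ = pointHF d`;
* **`hilbert_span_X_pow_colon_cone`** / **`_cone_self`** (Rem. 7.2): for the cone `J(pt, Z₂)`,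
  `HF(k) = Σ_{a = k+2−d}^{k} HF_{[Z₂]}(a)`, at `k = d`: `Σ_{a=2}^{d} HF_{[Z₂]}(a)` — lit-g8's CONE IDENTITY
  (`conv_pointHF`, `coneHF_self` of `JoinHilbertFunction.lean`) as a statement about the ideals.
NOT formalised: `P_{J(Z₁,Z₂)} = P_{Z₁}·P_{Z₂}` and (2.3) `T_tV_λ = J^{F,λ}_d`. HONEST FRAMING (cell pub-hlocus):
certified instances and evidence bearing on the general Hodge conjecture; no claim.
-/

noncomputable section

open MvPolynomial Module Literature.RingTheory.MvPolynomial Literature.AlgebraicGeometry.Kloosterman2025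
  Literature.AlgebraicGeometry.DuqueFrancoVillaflor2025

namespace Literature.AlgebraicGeometry.HodgeTheory

variable {K : Type*} [Field K] {σ τ : Type*} {e : ℕ}

/-- **Corollary 6.1 at the Fermat point**: for forms `P ∉ (x_i^e)` of degree `e₁ ≤ |σ|(e−1)` and
`Q ∉ (y_j^e)` of degree `e₂ ≤ |τ|(e−1)`, the Hilbert function of `S/((x_k^e : k ∈ σ ⊔ τ) : P(x)Q(y))` is the
convolution `Σ_{p+q=k} h_{(J_σ:P)}(p) · h_{(J_τ:Q)}(q)` — "`HF_{[J(Z₁,Z₂)]} = HF_{[Z₁]} * HF_{[Z₂]}`, this means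
that for all `k ≥ 0`, `HF_{[J(Z₁,Z₂)]}(k) = Σ_{p+q=k} HF_{[Z₁]}(p)·HF_{[Z₂]}(q)`" for `HF_λ` the Hilbert function of
`S/(J^F : P_λ)` (Def. 6.1), granted `P_{J(Z₁,Z₂)} = P_{Z₁}·P_{Z₂}`. [cite: DuqueFrancoVillaflor2025Join, Corollary 6.1] -/
theorem hilbert_span_X_pow_colon_rename_mul [Fintype σ] [Fintype τ] (he : 1 ≤ e)
    {P : MvPolynomial σ K} {Q : MvPolynomial τ K} {e₁ s₁ e₂ s₂ : ℕ} (hP : P.IsHomogeneous e₁)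
    (hes₁ : e₁ + s₁ = Fintype.card σ * (e - 1))
    (hPJ : P ∉ Ideal.span (Set.range fun i : σ => (X i : MvPolynomial σ K) ^ e))
    (hQ : Q.IsHomogeneous e₂) (hes₂ : e₂ + s₂ = Fintype.card τ * (e - 1))
    (hQJ : Q ∉ Ideal.span (Set.range fun j : τ => (X j : MvPolynomial τ K) ^ e)) (k : ℕ) :
    finrank K (homogeneousSubmodule (σ ⊕ τ) K k) -
        finrank K (idealDegree ((Ideal.span (Set.range fun k : σ ⊕ τ => (X k : MvPolynomial (σ ⊕ τ) K) ^ e)).colon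
          {rename Sum.inl P * rename Sum.inr Q}) k) =
      conv (fun p => finrank K (homogeneousSubmodule σ K p) -
          finrank K (idealDegree ((Ideal.span (Set.range fun i : σ => (X i : MvPolynomial σ K) ^ e)).colon {P}) p))
        (fun q => finrank K (homogeneousSubmodule τ K q) -
          finrank K (idealDegree ((Ideal.span (Set.range fun j : τ => (X j : MvPolynomial τ K) ^ e)).colon {Q}) q))
        k := by
  rw [span_X_pow_sum_eq]
  exact (isArtinianGorenstein_span_X_pow (K := K) (ι := σ) he).hilbert_colon_join
    (isArtinianGorenstein_span_X_pow (K := K) (ι := τ) he) hP hes₁ hPJ hQ hes₂ hQJ k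

/-! ## Cones `Z = J(pt, Z₂)` (Remark 7.2, Example 6.1) -/

/-- **Example 6.1 at the level of ideals**: for a point `pt` of the `0`-dimensional Fermat variety
`{x₀^{e+1} + x₁^{e+1} = 0} ⊂ ℙ¹` (more generally any `c`, fake or not), `P_pt = Σ_{l<e} x₀^l (c x₁)^{e−1−l}` and
`(x₀^e, x₁^e) : P_pt = ⟨x₀ − c x₁, x₀^e, x₁^e⟩` has Hilbert function `φ(k) = 1` for `0 ≤ k ≤ d − 2` and `0`
otherwise (`d = e + 1`; tree `pointHF`): "`φ` is the Hilbert function of a point in a `0`-dimensional Fermat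
variety". [cite: DuqueFrancoVillaflor2025Join, Example 6.1] -/
theorem hilbert_span_X_pow_colon_fermatPoint (he : 1 ≤ e) (c : Unit → K) (a : ℕ) :
    finrank K (homogeneousSubmodule (Unit ⊕ Unit) K a) -
        finrank K (idealDegree ((Ideal.span (Set.range fun i : Unit ⊕ Unit =>
          (X i : MvPolynomial (Unit ⊕ Unit) K) ^ e)).colon {fermatLinearCyclePolynomial c e}) a) =
      pointHF (e + 1) a := by
  classical
  rw [span_X_pow_colon_fermatLinearCyclePolynomial c e he, hilbert_fermatLinearCycleIdeal_eq_card c e he a,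
    pointHF]
  have hmem : ∀ β : Unit →₀ ℕ, β ∈ Finset.filter (fun β : Unit →₀ ℕ => ∀ j, β j ≤ e - 1)
      ((Finset.univ : Finset Unit).finsuppAntidiag a) ↔ β = Finsupp.single () a ∧ a ≤ e - 1 := by
    intro β
    rw [Finset.mem_filter, Finset.mem_finsuppAntidiag]
    constructor
    · rintro ⟨⟨hsum, -⟩, hle⟩
      have hβ : β () = a := by simpa using hsum
      refine ⟨?_, hβ ▸ hle ()⟩
      ext
      rw [Finsupp.single_eq_same, hβ]
    · rintro ⟨rfl, hle⟩
      refine ⟨⟨by simp, Finset.subset_univ _⟩, fun j => ?_⟩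
      rw [Finsupp.single_eq_same]
      exact hle
  by_cases ha : a + 2 ≤ e + 1
  · rw [if_pos ha, Finset.card_eq_one]
    refine ⟨Finsupp.single () a, Finset.eq_singleton_iff_unique_mem.mpr ⟨(hmem _).mpr ⟨rfl, by omega⟩, ?_⟩⟩
    exact fun β hβ => ((hmem β).mp hβ).1
  · rw [if_neg ha, Finset.card_eq_zero, Finset.eq_empty_iff_forall_notMem]
    intro β hβ
    have := ((hmem β).mp hβ).2
    omega

/-- **Remark 7.2 (cones) + Corollary 6.1 + Example 6.1, at the Fermat point**: for the cone `Z = J(pt, Z₂)`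
over a cycle `Z₂` two dimensions down — `P_Z = P_pt(x₀,x₁) · Q(y)` (Thm. 1.1), `Q = P_{Z₂} ∉ (y_j^e)` a form of
degree `e₂ ≤ |τ|(e−1)` — the Hilbert function of `S/(J : P_pt(x)Q(y))` is
`k ↦ Σ_{a = k+2−d}^{k} h_{(J_τ : Q)}(a)` (`d = e + 1`): `HF_{[J(pt,Z₂)]} = φ * HF_{[Z₂]}`; at `k = d` this is the
census CONE RANK FORMULA `HF_{[Z]}(d) = Σ_{a=2}^{d} HF_{[Z₂]}(a)` (tree `coneHF_self`).
[cite: DuqueFrancoVillaflor2025Join, Remark 7.2] [cite: DuqueFrancoVillaflor2025Join, Corollary 6.1] -/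
theorem hilbert_span_X_pow_colon_cone [Fintype τ] (he : 1 ≤ e) (c : Unit → K) {Q : MvPolynomial τ K}
    {e₂ s₂ : ℕ} (hQ : Q.IsHomogeneous e₂) (hes₂ : e₂ + s₂ = Fintype.card τ * (e - 1))
    (hQJ : Q ∉ Ideal.span (Set.range fun j : τ => (X j : MvPolynomial τ K) ^ e)) (k : ℕ) :
    finrank K (homogeneousSubmodule ((Unit ⊕ Unit) ⊕ τ) K k) -
        finrank K (idealDegree ((Ideal.span (Set.range fun i : (Unit ⊕ Unit) ⊕ τ =>
          (X i : MvPolynomial ((Unit ⊕ Unit) ⊕ τ) K) ^ e)).colon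
          {rename Sum.inl (fermatLinearCyclePolynomial c e) * rename Sum.inr Q}) k) =
      ∑ a ∈ Finset.Icc (k + 2 - (e + 1)) k,
        (finrank K (homogeneousSubmodule τ K a) -
          finrank K (idealDegree ((Ideal.span (Set.range fun j : τ => (X j : MvPolynomial τ K) ^ e)).colon {Q}) a)) := by
  have hP : (fermatLinearCyclePolynomial c e : MvPolynomial (Unit ⊕ Unit) K).IsHomogeneous (e - 1) := by
    simpa using isHomogeneous_fermatLinearCyclePolynomial c e
  have hes₁ : (e - 1) + (e - 1) = Fintype.card (Unit ⊕ Unit) * (e - 1) := by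
    rw [Fintype.card_sum, Fintype.card_unit]; ring
  rw [hilbert_span_X_pow_colon_rename_mul he hP hes₁ (fermatLinearCyclePolynomial_not_mem c e he) hQ hes₂ hQJ k,
    ← conv_pointHF, conv_comm]
  congr 1
  funext a
  exact hilbert_span_X_pow_colon_fermatPoint he c a

/-- … in particular at `k = d = e + 1`: **`HF_{[J(pt,Z₂)]}(d) = Σ_{a=2}^{d} HF_{[Z₂]}(a)`** — the codimension of
the Zariski tangent space of the Hodge locus of a cone, granted (2.3) `T_tV_λ = J^{F,λ}_d` (NOT formalised).
[cite: DuqueFrancoVillaflor2025Join, Remark 7.2] [cite: DuqueFrancoVillaflor2025Join, Corollary 6.1] -/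
theorem hilbert_span_X_pow_colon_cone_self [Fintype τ] (he : 1 ≤ e) (c : Unit → K) {Q : MvPolynomial τ K}
    {e₂ s₂ : ℕ} (hQ : Q.IsHomogeneous e₂) (hes₂ : e₂ + s₂ = Fintype.card τ * (e - 1))
    (hQJ : Q ∉ Ideal.span (Set.range fun j : τ => (X j : MvPolynomial τ K) ^ e)) :
    finrank K (homogeneousSubmodule ((Unit ⊕ Unit) ⊕ τ) K (e + 1)) -
        finrank K (idealDegree ((Ideal.span (Set.range fun i : (Unit ⊕ Unit) ⊕ τ =>
          (X i : MvPolynomial ((Unit ⊕ Unit) ⊕ τ) K) ^ e)).colon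
          {rename Sum.inl (fermatLinearCyclePolynomial c e) * rename Sum.inr Q}) (e + 1)) =
      ∑ a ∈ Finset.Icc 2 (e + 1),
        (finrank K (homogeneousSubmodule τ K a) -
          finrank K (idealDegree ((Ideal.span (Set.range fun j : τ => (X j : MvPolynomial τ K) ^ e)).colon {Q}) a)) := by
  rw [hilbert_span_X_pow_colon_cone he c hQ hes₂ hQJ (e + 1), Nat.add_sub_cancel_left]

end Literature.AlgebraicGeometry.HodgeTheory

end
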